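import Mathlib.Analysis.SpecialFunctions.Complex.Circle
import Literature.Computability.AlgebraicComplexity.PlethysmTableauEvaluation
import Literature.Computability.Complexity.Reductions
import Literature.Computability.Complexity.Counting
import Literature.Computability.Complexity.BoolEncodings
import Literature.Computability.FineGrained.FineGrainedWave0
import Literature.Combinatorics.SimpleGraph.TreeDecomposition
import HarnessLib

/-!
# Bläser–Dörfler–Ikenmeyer 2020/2021, §5, §7, §8: evaluation of tableau highest weight vectors at
# points of small Waring rank — the treewidth question and NP- / #P-hardness of evaluation

Typed literature (cell `val-lit`, cross-ladder typing seat x6; D-0064 one file per source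
section-group; this file = §5 "Highest weight vectors and their combinatorial evaluation" (the
evaluation formula), §7 "Treewidth of Young tableaux" (Prop 7.5, Question 7.6) and §8 "Hardness of
evaluation" (Thms 8.1, 8.2, 8.9); the sibling `BDI20WaringRankABPWidth.lean` types §4 and §6).
HONEST FRAMING: cite-tagged statements of published results; typed ≠ proved ≠ endorsed;
`VP ≠ VNP` is NOT proved and nothing here is progress on it (LADDER-VALIANT V4, row N4
"constructivity side": how hard it is to EVALUATE the highest-weight-vector separating functions
that every GCT lower bound can in principle be phrased with).

Source: M. Bläser, J. Dörfler, C. Ikenmeyer, *On the complexity of evaluating highest weight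
vectors*, arXiv:2002.11594 [BlaserDorflerIkenmeyer2020]; published CCC 2021, LIPIcs 200, Art. 29,
doi:10.4230/LIPIcs.CCC.2021.29. NUMBERING as in the sibling file: decl names / cite tags use the
PUBLISHED numbering (checked on the LIPIcs text `paper:url-50d0afcf7594`, page `29:N` = file
`p00NN.txt`); the held arXiv text `paper:arxiv-2002.11594` numbers sequentially: arXiv `Def 3` =
CCC Def 5.1, `Lemma 4/5` = Lemmas 5.2/5.3, `Remark 6` = Rem 5.4, `Theorem 8` = Thm 6.2, `Def 16` =
Def 7.1, `Theorem 17` = Thm 7.2, `Prop 19/20` = Props 7.4/7.5, `Question 21` = Question 7.6,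
`Theorem 22` = Thm 8.1, `Theorem 23` = Thm 8.2, `Def 24` = Def 8.3, `Lemmas 25–29` = Lemmas 8.4–8.8,
`Theorem 30` = Thm 8.9, `Remark 31` = Rem 8.10. Statements agree between the versions except that
CCC Thm 8.1 says "at a fixed point `p = p_d`" where arXiv Thm 22 says "at a point `p`" (the proof fixes
`p` in both).

## The object (§5) and its rendering

For a Young tableau `T̂` of shape `λ ⊢ nd` with CONTENT `n × d` (the labels `1..n` each occur `d`
times; here labels are `0..n-1`) the highest weight vector `f_T̂ ∈ HWV_λ(Sym^n Sym^d ℂ^m)` is a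
degree-`n` polynomial function on degree-`d` forms in `m` variables; at a point of Waring rank `r`,
`p = Σ_{i<r} ℓ_i^d`, its value is (eq. (5.1)/(sumpropertheta) with Rem 5.4 = arXiv Rem 6: "From eq.
(5.1) and writing `p` in its Waring rank decomposition, we immediately get an
`O(WR(p)^n · poly(n,d,m))` algorithm")
`f_T̂(p) = Σ_{κ : labels → [r]} ∏_{columns c} det_c(κ)`, where `det_c(κ)` is the determinant of the
top `μ_c × μ_c` square part of the `m × μ_c` matrix whose columns are the forms `ℓ_{κ(u)}` placed in
the boxes `u` of `c` ("We define the determinant of a matrix that has more rows than columns as the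
determinant of its largest top square submatrix", arXiv p0008.txt:L57). This is
`BDI2020.hwvEvalWaring T n L` below, for forms given as coefficient LISTS over any commutative ring
(so that the same definition serves `ℤ`-, `ℂ`- and cyclotomic points); the tableau `T` is the list
of its columns, each the list of its labels top to bottom. It is the `d!`-free Waring-point
specialisation of the tree's multilinear `TableauEval.eval` (`PlethysmTableauEvaluation.lean`, whose
sum over box↔form bijections multiplies each term by `(d!)^n` at a Waring point); only `ldet` is
reused from there. Normalisations are immaterial: every typed statement is about (non)vanishing or
about #P-hardness of the exact value (invariant under a fixed nonzero integer factor).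

DECISION PROBLEMS (§8) are typed in the tree's Boolean framework exactly as for BIJL 2018
(`Barriers/ValiantsHypothesis/BIJL18MatrixCompletion.lean`): instances are tableaux `T̂`
(`List (List ℕ)`, Boolean-encoded by `tableauEncoding`); the evaluation point is the FIXED point of
the printed proof (CCC Thm 8.1: "at a fixed point `p = p_d ∈ Sym^d ℂ^m` of Waring rank 3"), so the
hardness of this sub-problem is the printed hardness; "deciding whether `f_T̂(p) = 0` is NP-hard" is
typed as Karp NP-hardness (tree `IsNPHard`) of the language of NONVANISHING instances — the printed
reductions map `G ↦ T̂` with "`f_T̂(p) ≠ 0` iff `G` is properly 3-colourable", i.e. they are Karp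
reductions to nonvanishing; the vanishing problem is its complement (coNP-hard under Karp, NP-hard
under polynomial-time Turing reductions — the informal printed sense). "#P-hard" (Thm 8.2) is the
tree's Cook hardness `IsSharpPHardFun` of the value function, with the value `f_T̂(p) ∈ ℤ[e^{iπ/3}]`
output through its (unique) coordinates in the basis `(1, e^{iπ/3})` (`eisensteinCoords`, a
polynomial-time bijective recoding). ETH clauses use the tree's `FineGrained.ETH`,
`ComputesInTime`, `IsExpPolyBound` (`FineGrainedWave0.lean`): "no `2^{o(n)}` algorithm" = no deciding
machine whose instance-dependent time bound `T(n, L)` is `O(2^{δ n} · poly(L))` for EVERY `δ > 0`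
(`n` = number of labels of the instance, `L` = its encoding length).

FACT-LIST marks: `-- FACT` (published, unproved here; `def … : Prop`, never asserted), `-- OPEN
QUESTION` (printed as open; neutral, never asserted), `-- PROVED` (definitions / kernel sanity values).
No `instance`, no `notation`. NOT typed in this file: Thm 6.2 and Thm 7.2 (arXiv Thms 8, 17: the
`O(w^{n+r} poly)` dynamic programme and the `w^{ω(τ+1)} poly` tree-decomposition algorithm for points
given by an ncABP of width `w`) — unit-cost algebraic-RAM running-time statements for which the tree
has no cost model (their mathematical content is the evaluation formula typed here; recorded for the
faithfulness sheet as NOT-TYPED); Lemmas 8.4–8.8 (the graph-colouring reductions); Rem 8.10.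

v2 (seat x6 g2, 2026-08-26) — CORRECTION OF A TYPING DEFECT (ours, not the paper's) in §7. v1 typed
Prop 7.5 (1) and Question 7.6 for "every semistandard `S` with columns of height `≤ 2` (resp. `≤ r`)
and entries `< n`", OMITTING the Young-diagram SHAPE of Def 5.1 (the paper's `S` is a semistandard
Young TABLEAU: nonempty columns of weakly decreasing heights). Since `IsSemistandard` compares only
CONSECUTIVE columns, on the rows the later column has, inserting an empty column before each two-box
column `[i, j]` satisfies every v1 hypothesis and realises an ARBITRARY graph as `tableauGraph S n` —
e.g. `K_n`, of treewidth `n - 1` — so both v1 statements were FALSE AS TYPED (kernel evidence: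
`not_BDI2020_prop_7_5_upper`, `not_BDI2020_question_7_6` in the cell's evidence file
`np/evidence/x6g2-BDI20Prop75MissingShape.lean`, against v1 @ a375608773b9; nobody consumed them).
v2 adds the two shape clauses of `IsTableauOfContent` — `∀ c ∈ S, c ≠ []` and
`S.Pairwise (fun c c' => c'.length ≤ c.length)` — to both declarations (all two-box columns then
precede the one-box columns, so `IsSemistandard` makes BOTH rows non-decreasing: the printed class;
labels `< n` that do not occur are isolated vertices, immaterial for an upper bound). Every other
declaration of v1 is byte-identical.

## References
* [BlaserDorflerIkenmeyer2020] arXiv:2002.11594 §5 (Def 3, eq. (sumpropertheta), Rem 6), §7 (Def 16,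
  Props 19–20, Question 21), §8 (Thms 22, 23, 30) = CCC 2021 LIPIcs 200:29, Def 5.1, eq. (5.1), Rem
  5.4 (p.29:8–29:9), Def 7.1, Props 7.4–7.5, Question 7.6 (pp.29:15, 29:21–29:23), Thms 8.1, 8.2
  (pp.29:23–29:24), Thm 8.9 (p.29:30).
* Tree vocabulary: `IsNPHard` (`Complexity/Reductions.lean`, Karp 1972), `IsSharpPHardFun`
  (`Complexity/Counting.lean`, Valiant 1979), `ETH`/`ComputesInTime`/`IsExpPolyBound`
  (`FineGrained/FineGrainedWave0.lean`, Impagliazzo–Paturi 2001), `treewidth`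
  (`Combinatorics/SimpleGraph/TreeDecomposition.lean`), `TableauEval.ldet`
  (`PlethysmTableauEvaluation.lean`).
-/

noncomputable section

open _root_.Computability

namespace Literature.Computability.AlgebraicComplexity

namespace BDI2020

/-! ### §5 Def 5.1 (arXiv Def 3): Young tableaux with content `n × d`; semistandardness -/

-- PROVED (definition)
/-- **Young tableau with content `n × d`** (Def 5.1 = arXiv Def 3: "a left justified array of boxes
where row `i` contains `λ_i` boxes and each box contains a positive integer. If the tableau contains
the numbers `1` through `n` each `d` times it is said to have (rectangular) content `n × d`"), for a
tableau given as the list of its COLUMNS (each the list of its entries top to bottom, labels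
`0, …, n-1`): columns nonempty with weakly decreasing heights (the shape is a partition), every
entry `< n`, every label occurring exactly `d` times.
[cite: BlaserDorflerIkenmeyer2020, Def 3 (arXiv; = CCC 2021 Def 5.1)] locator:
paper:arxiv-2002.11594 p0008.txt:L39-41; CCC p.29:8 "▶ Definition 5.1" -/
def IsTableauOfContent (T : List (List ℕ)) (n d : ℕ) : Prop :=
  (∀ c ∈ T, c ≠ []) ∧ T.Pairwise (fun c c' => c'.length ≤ c.length) ∧
    (∀ c ∈ T, ∀ u ∈ c, u < n) ∧ ∀ u, u < n → (T.map (List.count u)).sum = d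

-- PROVED (definition)
/-- **Semistandard**: "the entries are strictly increasing in each column and non-decreasing in
each row" (Def 5.1 = arXiv Def 3); columns as lists top to bottom, rows read across consecutive
columns. [cite: BlaserDorflerIkenmeyer2020, Def 3 (arXiv; = CCC 2021 Def 5.1)] locator:
paper:arxiv-2002.11594 p0008.txt:L42 -/
def IsSemistandard (T : List (List ℕ)) : Prop :=
  (∀ c ∈ T, c.IsChain (· < ·)) ∧
    T.IsChain (fun c c' => ∀ i, i < c'.length → c.getD i 0 ≤ c'.getD i 0)

-- PROVED (definition)
/-- The number of labels of a tableau with labels `0, …, n-1`: `1 + ` the largest entry (the `n` of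
an `n × d` content; `1` for the empty tableau). [cite: BlaserDorflerIkenmeyer2020, Def 3 (arXiv; = CCC 2021 Def 5.1)] -/
def numLabels (T : List (List ℕ)) : ℕ :=
  (T.map fun c => c.foldr max 0).foldr max 0 + 1

/-! ### §5 eq. (5.1) at a point of Waring rank `r` (Rem 5.4 = arXiv Rem 6) -/

section Eval

variable {R : Type*} [CommRing R]

-- PROVED (definition)
/-- All placements `κ : {0..n-1} → {0..r-1}` of `r` forms on `n` labels, as lists of length `n`.
[cite: BlaserDorflerIkenmeyer2020, eq. (sumpropertheta) (arXiv p0008.txt:L45-61; = CCC 2021 eq. (5.1))] -/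
def placements (n r : ℕ) : List (List ℕ) :=
  (List.replicate n (List.range r)).sections

-- PROVED (definition)
/-- The column factor `det_{ϑ,c}`: the determinant of the top `μ_c × μ_c` square of the matrix of the
forms placed in column `c` (row = box, top to bottom; column `j < μ_c` = `j`-th coordinate) — "the
determinant of a matrix that has more rows than columns [is] the determinant of its largest top
square submatrix" (transposed, same value). Forms are dense coefficient lists; `TableauEval.ldet`
reads the first `μ_c` coordinates. [cite: BlaserDorflerIkenmeyer2020, eq. (sumpropertheta) (arXiv p0008.txt:L57-61; = CCC 2021 eq. (5.1))] -/
def colDet (L : List (List R)) (κ : List ℕ) (c : List ℕ) : R :=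
  TableauEval.ldet (c.map fun u => L.getD (κ.getD u 0) [])

-- PROVED (definition)
/-- **`f_T̂(ℓ_0^d + ⋯ + ℓ_{r-1}^d)`**, the value of the tableau highest weight vector of `T̂` (content
`n × d`, columns of labels) at a point given by a Waring decomposition `L = [ℓ_0, …, ℓ_{r-1}]`:
`Σ_{κ : labels → forms} ∏_c det_c(κ)` ("`ϑ` chooses one of the rank 1 tensors for each block of `d`
numbers and places those onto `T`. Then we take the product of the columnwise determinants. The
evaluation `f(p)` is now the sum over all possible choices"; Rem 5.4: at a Waring decomposition this
is an `O(WR(p)^n · poly)` sum). The degree `d` enters only through the content of `T̂`.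
[cite: BlaserDorflerIkenmeyer2020, eq. (sumpropertheta) and Rem 6 (arXiv p0008.txt:L61-67, p0009.txt:L30-32; = CCC 2021 eq. (5.1), Rem 5.4, pp.29:8–29:9)] -/
def hwvEvalWaring (T : List (List ℕ)) (n : ℕ) (L : List (List R)) : R :=
  ((placements n L.length).map fun κ => (T.map fun c => colDet L κ c).prod).sum

-- PROVED (kernel sanity value)
/-- "The smallest example is the discriminant polynomial `b² - 4ac` in `HWV_{(2,2)}(Sym² Sym² ℂ²)`"
(§5): the tableau with two columns `0|1`, `0|1` (content `2 × 2`) evaluated at `x² + y²`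
(`ℓ_0 = (1,0)`, `ℓ_1 = (0,1)`; `(a,b,c) = (1,0,1)`, discriminant `-4`) gives `2` (the two
placements `κ = (0,1), (1,0)` contribute `det² = 1` each) — a nonzero multiple, as it must be.
[cite: BlaserDorflerIkenmeyer2020, §5 (arXiv p0008.txt:L33; = CCC 2021 p.29:8)] -/
example : hwvEvalWaring [[0, 1], [0, 1]] 2 ([[1, 0], [0, 1]] : List (List ℤ)) = 2 := by
  decide +kernel

end Eval

/-! ### §7: the graph of a tableau, Prop 7.5 and Question 7.6 (arXiv Prop 20, Question 21) -/

-- PROVED (definition)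
/-- **The graph `G_S` of a tableau** `S` with entries in `{0..n-1}`: vertices the labels, `{i, j}` an
edge "iff `i` and `j` are contained in some common column in `S`" (§7, first paragraph; multiple
columns give a multigraph in print, irrelevant for treewidth). [cite: BlaserDorflerIkenmeyer2020, §7 (arXiv p0013.txt:L4; = CCC 2021 §7, p.29:14)] -/
def tableauGraph (S : List (List ℕ)) (n : ℕ) : SimpleGraph (Fin n) :=
  SimpleGraph.fromRel fun i j => ∃ c ∈ S, i.val ∈ c ∧ j.val ∈ c

end BDI2020

section Section7

open BDI2020 Literature.Combinatorics.SimpleGraph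

-- FACT (from the planar excluded-grid theorem [RobertsonSeymourThomas94] via Prop 7.4: `G_S` is planar)
/-- **BDI Prop 7.5 (1) (arXiv Prop 20 (1)).** "Let `S_n` be a semistandard Young tableau with two rows
containing the numbers `{1, …, n}`. Then `G_{S_n}` has treewidth at most `O(√n)`." Typed: one
absolute constant `C` with `tw(G_S) ≤ C · (⌊√n⌋ + 1)` for every `n` and every semistandard Young
tableau `S` of (partition) shape with columns of height `≤ 2` — nonempty columns of weakly
decreasing heights (the shape clauses of Def 5.1 / `IsTableauOfContent`), entries `< n`. (Clause
(2), a family with treewidth `Ω(√n)`, is not typed.) ERRATUM (v2, x6 g2): v1 omitted the two shape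
clauses, which let empty columns interleave and made `tableauGraph S n` arbitrary (`K_n`) — v1 was
false as typed; see the module docstring.
[cite: BlaserDorflerIkenmeyer2020, Prop 20 (1) (arXiv; = CCC 2021 Prop 7.5 (1))] locator:
paper:arxiv-2002.11594 p0016.txt:L18-22; CCC p.29:21 "▶ Proposition 7.5." -/
def BDI2020_prop_7_5_upper : Prop :=
  ∃ C : ℕ, ∀ (n : ℕ) (S : List (List ℕ)), (∀ c ∈ S, c ≠ []) →
    S.Pairwise (fun c c' => c'.length ≤ c.length) → IsSemistandard S → (∀ c ∈ S, c.length ≤ 2) →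
    (∀ c ∈ S, ∀ u ∈ c, u < n) → treewidth (tableauGraph S n) ≤ C * (Nat.sqrt n + 1)

-- OPEN QUESTION (printed as open; neutral statement, NOT asserted)
/-- **BDI Question 7.6 (arXiv Question 21).** "It is open whether the bound of `O(√n)` on the
treewidth can be extended to any other constant number of rows, but starting at `3` rows `G_S`
becomes non-planar …". Typed, for a fixed number of rows `r ≥ 3`: is there a constant `C_r` with
`tw(G_S) ≤ C_r (⌊√n⌋ + 1)` for all semistandard Young tableaux `S` of (partition) shape — nonempty
columns of weakly decreasing heights — with columns of height `≤ r` and entries `< n`? (The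
quantifier over `r` is outside: one `Prop` per `r`.) Status: open (CCC 2021). ERRATUM (v2, x6 g2):
v1 omitted the two shape clauses and was (trivially) false for every `r ≥ 2`; see the module
docstring. [cite: BlaserDorflerIkenmeyer2020, Question 21 (arXiv; = CCC 2021 Question 7.6)] locator:
paper:arxiv-2002.11594 p0016.txt:L67-68; CCC p.29:23 "▶ 7.6 Question." -/
def BDI2020_question_7_6 (r : ℕ) : Prop :=
  ∃ C : ℕ, ∀ (n : ℕ) (S : List (List ℕ)), (∀ c ∈ S, c ≠ []) →
    S.Pairwise (fun c c' => c'.length ≤ c.length) → IsSemistandard S → (∀ c ∈ S, c.length ≤ r) →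
    (∀ c ∈ S, ∀ u ∈ c, u < n) → treewidth (tableauGraph S n) ≤ C * (Nat.sqrt n + 1)

end Section7

/-! ### §8: the decision / evaluation problems as Boolean languages and functions -/

namespace BDI2020

open Literature.Computability.Complexity

-- PROVED (definition)
/-- Boolean encoding of a tableau instance (list of columns, each a list of labels).
[cite: BlaserDorflerIkenmeyer2020, Thm 22 (arXiv; = CCC 2021 Thm 8.1: "given as a Young tableau T̂")] -/
def tableauEncoding : Encoding (List (List ℕ)) Bool :=
  encodingNatBool.listBool.listBool

-- PROVED (definition)
/-- The fixed point of Thm 8.1: `p_d = ℓ_1^d + ℓ_2^d + ℓ_3^d` with "`ℓ_1 = (1, 0, 0, …)`,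
`ℓ_2 = (1, 1, 0, …)`, `ℓ_3 = (1, 2, 0, …) ∈ ℂ^m`" (trailing zero coordinates omitted: only the top
`μ_c ≤ 2` coordinates enter a column determinant of a tableau with columns of height `≤ 2`; for
higher columns missing coordinates read as `0`, as printed). Waring rank `3`, real entries.
[cite: BlaserDorflerIkenmeyer2020, Thm 22, proof (arXiv p0017.txt:L33; = CCC 2021 Thm 8.1, p.29:23)] -/
def point₃ : List (List ℂ) :=
  [[1, 0], [1, 1], [1, 2]]

-- PROVED (definition)
/-- The fixed point of Thm 8.2: `ℓ_1 = (1, 0, …)`, `ℓ_2 = (1, e^{iπ/3}, 0, …)`,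
`ℓ_3 = (1, e^{2iπ/3}, 0, …) ∈ ℂ^m` ("the determinant of any two distinct linear forms of these is a
`6`-th root of unity"). [cite: BlaserDorflerIkenmeyer2020, Thm 23, proof (arXiv p0018.txt:L5-6; = CCC 2021 Thm 8.2, p.29:24)] -/
def point₃ω : List (List ℂ) :=
  [[1, 0], [1, Complex.exp (Real.pi * Complex.I / 3)], [1, Complex.exp (2 * Real.pi * Complex.I / 3)]]

-- PROVED (definition)
/-- The fixed point of Thm 8.9: `p = Σ_{i=1}^5 ℓ_i^d`, "`ℓ_i = (1, i, i², i³, …)`" (Vandermonde rows;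
coordinates beyond the fifth never enter: the tableau has `5` rows). Waring rank `5`, real entries.
[cite: BlaserDorflerIkenmeyer2020, Thm 30, proof (arXiv p0021.txt:L20-21; = CCC 2021 Thm 8.9, p.29:31)] -/
def point₅ : List (List ℂ) :=
  (List.range 5).map fun i => (List.range 5).map fun j => ((i + 1 : ℕ) : ℂ) ^ j

-- PROVED (definition)
/-- YES-instances of the evaluation problem of Thm 8.1 for the parameters `(d, m)`: tableaux `T̂` of
content `n × d` (some `n`) with columns of height `≤ m` — so that `f_T̂ ∈ HWV(Sym^n Sym^d ℂ^m)` — whose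
value at the fixed point `p_d` is NONZERO. [cite: BlaserDorflerIkenmeyer2020, Thm 22 (arXiv; = CCC 2021 Thm 8.1)] -/
def nonvanishingSet₃ (d m : ℕ) : Set (List (List ℕ)) :=
  {T | ∃ n, IsTableauOfContent T n d ∧ (∀ c ∈ T, c.length ≤ m) ∧ hwvEvalWaring T n point₃ ≠ 0}

-- PROVED (definition)
/-- YES-instances of the evaluation problem of Thm 8.9 for `(d, m)`: SEMISTANDARD tableaux of content
`n × d` with columns of height `≤ m` whose value at the fixed Waring-rank-`5` point is nonzero.
[cite: BlaserDorflerIkenmeyer2020, Thm 30 (arXiv; = CCC 2021 Thm 8.9)] -/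
def nonvanishingSetSemistd (d m : ℕ) : Set (List (List ℕ)) :=
  {T | ∃ n, IsTableauOfContent T n d ∧ IsSemistandard T ∧ (∀ c ∈ T, c.length ≤ m) ∧
    hwvEvalWaring T n point₅ ≠ 0}

-- PROVED (definition)
/-- Coordinates of an element `z = a + b·e^{iπ/3}` of `ℤ[e^{iπ/3}]` in the `ℤ`-basis `(1, e^{iπ/3})`
(`e^{iπ/3} = 1/2 + (√3/2) i`, so `b = 2 Im z/√3`, `a = Re z - b/2`; rounded, exact on the lattice).
Used to output the value `f_T̂(p) ∈ ℤ[e^{iπ/3}]` of Thm 8.2 as a bit string.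
[cite: BlaserDorflerIkenmeyer2020, Thm 23, proof (arXiv p0018.txt:L5-8; = CCC 2021 Thm 8.2)] -/
def eisensteinCoords (z : ℂ) : ℤ × ℤ :=
  let b := round (2 * z.im / Real.sqrt 3)
  (round (z.re - (b : ℝ) / 2), b)

-- PROVED (definition)
/-- **The value function of Thm 8.2** for the parameters `(d, m)`, as a function on bit strings: on
the encoding of a tableau `T̂` of content `n × d` (`n = numLabels T̂`) with columns of height `≤ m`,
the value `f_T̂(ℓ_1^d + ℓ_2^d + ℓ_3^d)` at the fixed point `point₃ω`, output as the natural number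
`⟨a, b⟩` (Cantor pairing of the `ℤ ≃ ℕ`-recoded Eisenstein coordinates); `0` on all other strings.
[cite: BlaserDorflerIkenmeyer2020, Thm 23 (arXiv; = CCC 2021 Thm 8.2)] -/
def hwvValueFun (d m : ℕ) (x : List Bool) : ℕ :=
  match tableauEncoding.decode x with
  | none => 0
  | some T => by
    classical
    exact if IsTableauOfContent T (numLabels T) d ∧ ∀ c ∈ T, c.length ≤ m then
      Nat.pair (Equiv.intEquivNat (eisensteinCoords (hwvEvalWaring T (numLabels T) point₃ω)).1)
        (Equiv.intEquivNat (eisensteinCoords (hwvEvalWaring T (numLabels T) point₃ω)).2)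
    else 0

-- PROVED (definition)
/-- "There is a `2^{o(n)}`-time algorithm deciding membership in `S`" (`n` = number of labels of the
instance, `L` = encoding length), in the tree's machine model: a deterministic machine decides `S` on
every tableau instance within `T(g(n), L)` steps for a two-parameter bound that is
`O(2^{δ k} · poly(L))` for EVERY `δ > 0` (tree `IsExpPolyBound`, `ComputesInTime`); `g` rescales the
parameter (`g = id` for `2^{o(n)}`, `g = ⌊√·⌋` for `2^{o(√n)}`).
[cite: BlaserDorflerIkenmeyer2020, Thms 22, 30 (arXiv; = CCC 2021 Thms 8.1, 8.9: "no 2^{o(n)} algorithm", "can not be computed in time 2^{o(√n)}")] -/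
def HasSubexpDecider (S : Set (List (List ℕ))) (g : ℕ → ℕ) : Prop :=
  ∃ T : ℕ → ℕ → ℕ, (∀ δ : ℝ, 0 < δ → Literature.Computability.FineGrained.IsExpPolyBound δ T) ∧
    Literature.Computability.FineGrained.ComputesInTime tableauEncoding.encode encodeBool
      (fun x => by classical exact decide (x ∈ S))
      (fun x => T (g (numLabels x)) (tableauEncoding.encode x).length)

end BDI2020

/-! ### §8 Theorems 8.1, 8.2, 8.9 (arXiv Theorems 22, 23, 30) -/

section Section8

open BDI2020 Literature.Computability.Complexity Literature.Computability.FineGrained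

-- FACT (reduction from 3-colourability of graphs of maximum degree 4 [GareyJohnsonStockmeyer76])
/-- **BDI Thm 8.1 (arXiv Thm 22), NP-hardness.** "Deciding whether a highest weight vector `f_T̂` of
`Sym^n Sym^d ℂ^m` given as a Young tableau `T̂` evaluates to zero at a fixed point `p = p_d ∈
Sym^d ℂ^m` of Waring rank `3` is NP-hard for constant `d ≥ 8`, `m ≥ 2`." Typed: for every `d ≥ 8`,
`m ≥ 2`, the language of (encoded) tableaux of content `n × d`, columns of height `≤ m`, with
`f_T̂(p_d) ≠ 0` is Karp-NP-hard (the printed reduction: `f_T̂(p) ≠ 0` iff `G` properly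
3-colourable; vanishing = the complement problem, see the module docstring).
[cite: BlaserDorflerIkenmeyer2020, Thm 22 (arXiv; = CCC 2021 Thm 8.1)] locator:
paper:arxiv-2002.11594 p0017.txt:L17-19; CCC p.29:23 "▶ Theorem 8.1" -/
def BDI2020_thm_8_1 : Prop :=
  ∀ d m : ℕ, 8 ≤ d → 2 ≤ m → IsNPHard (tableauEncoding.toLanguage (nonvanishingSet₃ d m))

-- FACT (reduction as above, with the `2^{o(|V|)}` ETH lower bound for 3-colouring [ImpagliazzoPaturiZane01])
/-- **BDI Thm 8.1 (arXiv Thm 22), ETH clause.** "Assuming ETH no `2^{o(n)}` algorithm for this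
evaluation can exist" (`n` = the number of labels, i.e. `f_T̂ ∈ Sym^n Sym^d ℂ^m`). Typed with the
tree's `ETH` (Impagliazzo–Paturi) and `HasSubexpDecider · id`.
[cite: BlaserDorflerIkenmeyer2020, Thm 22 (arXiv; = CCC 2021 Thm 8.1)] locator:
paper:arxiv-2002.11594 p0017.txt:L21 "Assuming ETH no 2^{o(n)} algorithm for this evaluation can exist."; CCC p.29:23 -/
def BDI2020_thm_8_1_eth : Prop :=
  ETH → ∀ d m : ℕ, 8 ≤ d → 2 ≤ m → ¬ HasSubexpDecider (nonvanishingSet₃ d m) id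

-- FACT (reduction from counting 3-colourings of graphs of maximum degree 3 [BubleyDyerGreenhillJerrum99])
/-- **BDI Thm 8.2 (arXiv Thm 23), #P-hardness.** "Evaluating a highest weight vector `f_T̂` of
`Sym^n Sym^d ℂ^m` given as a Young tableau `T̂` at a point `p ∈ Sym^d ℂ^m` of Waring rank `3` is
#P-hard for constant `d ≥ 18`, `m ≥ 2`" (proof: at `ℓ_1 = (1,0,…)`, `ℓ_2 = (1, e^{iπ/3}, …)`,
`ℓ_3 = (1, e^{2iπ/3}, …)` "the evaluation `f_T̂(p)` counts exactly the number of 3-colorings of `G`").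
Typed: for every `d ≥ 18`, `m ≥ 2` the value function `BDI2020.hwvValueFun d m` (value at that fixed
point, Eisenstein coordinates, `0` off the well-formed instances) is #P-hard under polynomial-time
Turing reductions (tree `IsSharpPHardFun`).
[cite: BlaserDorflerIkenmeyer2020, Thm 23 (arXiv; = CCC 2021 Thm 8.2)] locator:
paper:arxiv-2002.11594 p0017.txt:L61-63; CCC p.29:24 "▶ Theorem 8.2" -/
def BDI2020_thm_8_2 : Prop :=
  ∀ d m : ℕ, 18 ≤ d → 2 ≤ m → IsSharpPHardFun (hwvValueFun d m)

-- FACT (reduction from 3-colourability of 8-regular grid-like layered graphs, Lemmas 8.4–8.8)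
/-- **BDI Thm 8.9 (arXiv Thm 30), NP-hardness for semistandard tableaux.** "The evaluation of highest
weight vectors `f_T̂` of `Sym^n Sym^d ℂ^m` is NP-hard for any constant `d ≥ 16` with `16 ∣ d` and
`m ≥ 5`, when `f_T̂` is given as a semistandard Young tableau `T̂`. This even holds if evaluation is
restricted to points of Waring rank `5` and the algorithm only has to decide whether the evaluation
is non-zero." Typed: Karp NP-hardness of the nonvanishing language at the fixed Waring-rank-`5` point
of the proof (`ℓ_i = (1, i, i², …)`, `i = 1..5`), semistandard instances with columns of height `≤ m`.
[cite: BlaserDorflerIkenmeyer2020, Thm 30 (arXiv; = CCC 2021 Thm 8.9)] locator: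
paper:arxiv-2002.11594 p0020.txt:L64, p0021.txt:L1-2; CCC p.29:30 "▶ Theorem 8.9" -/
def BDI2020_thm_8_9 : Prop :=
  ∀ d m : ℕ, 16 ≤ d → 16 ∣ d → 5 ≤ m →
    IsNPHard (tableauEncoding.toLanguage (nonvanishingSetSemistd d m))

-- FACT (Lemma 8.8: no `2^{o(√|V|)}` 3-colouring of 8-regular grid-like layered graphs under ETH)
/-- **BDI Thm 8.9 (arXiv Thm 30), ETH clause.** "Additionally this evaluation can not be computed in
time `2^{o(√n)}` unless ETH fails." Typed with `HasSubexpDecider · Nat.sqrt` (a bound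
`O(2^{δ ⌊√n⌋} poly(L))` for every `δ > 0`).
[cite: BlaserDorflerIkenmeyer2020, Thm 30 (arXiv; = CCC 2021 Thm 8.9)] locator:
paper:arxiv-2002.11594 p0021.txt:L4 "Additionally this evaluation can not be computed in time 2^{o(√n)} unless ETH fails."; CCC p.29:30 -/
def BDI2020_thm_8_9_eth : Prop :=
  ETH → ∀ d m : ℕ, 16 ≤ d → 16 ∣ d → 5 ≤ m →
    ¬ HasSubexpDecider (nonvanishingSetSemistd d m) Nat.sqrt

end Section8

end Literature.Computability.AlgebraicComplexity

end
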